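import Literature.MathematicalPhysics.QuantumFieldTheory.Wightman
import Literature.MathematicalPhysics.QuantumLattice.SchwartzTensorDensityProofs
import HarnessLib

/-!
# Poincaré invariance of the Wightman distributions (proof)

Discharge of the named fact `Literature.MathematicalPhysics.QuantumLattice.IsWightmanQFT.wightmanDistribution_poincare_invariant`
(`Literature/MathematicalPhysics/QuantumFieldTheory/Wightman.lean`; Streater–Wightman (1964), §3-3,
eq. (3-21), property (a) of the Wightman distributions): if `T` is the `n`-point Wightman
distribution of a Wightman QFT `W` (`IsWightmanDistributionOf W n k T`), then `T (g • F) = T F`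
for every `g` in the restricted Poincaré group.

Proof, as announced in the fact's docstring: the two continuous linear functionals
`T ∘ (g • ·)` and `T` agree on tensor products `f₁ ⊗ ⋯ ⊗ fₙ` — the Poincaré transform of a tensor
product is the tensor product of the transformed factors (`AQFT.IsTensorOf.poincareTestMulti`) and
the smeared Wightman functions are invariant (`IsWightmanQFT.wightmanFn_poincare_invariant`,
`WightmanAxioms`) — hence everywhere, by the density of the span of tensor products of real test
functions (`AQFT.denseSpan_tensorProducts_holds`, `SchwartzTensorDensityProofs`;
`AQFT.SchwingerFamily.ext_of_denseSpan`).

## References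

* R. F. Streater, A. S. Wightman, *PCT, Spin and Statistics, and All That* (1964), §3-3,
  eq. (3-21). [StreaterWightman1964]
-/

noncomputable section

open scoped SchwartzMap
open Literature.MathematicalPhysics.QuantumLattice

namespace Literature.MathematicalPhysics.QuantumFieldTheory

variable {d : ℕ} {κ : Type*} {n : ℕ}

/-- The Poincaré transform of a tensor product is the tensor product of the transformed factors:
`g • (f₁ ⊗ ⋯ ⊗ fₙ) = (g • f₁) ⊗ ⋯ ⊗ (g • fₙ)` (witness form). [folklore] -/
theorem _root_.Literature.MathematicalPhysics.QuantumLattice.IsTensorOf.poincareTestMulti {F : 𝓢((Fin n → SpaceTime d), ℂ)}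
    {f : Fin n → 𝓢(SpaceTime d, ℂ)} (hF : IsTensorOf F f) (g : PoincareGroup d) :
    IsTensorOf (poincareTestMulti n g F) fun i => poincareTest g (f i) := by
  intro x
  rw [poincareTestMulti_apply, hF]
  simp [poincareTest_apply]

/-- **Discharge of `IsWightmanQFT.wightmanDistribution_poincare_invariant`** (Streater–Wightman
(1964), §3-3, eq. (3-21): relativistic invariance of the Wightman distributions). The two
continuous functionals `T ∘ (g • ·)` and `T` agree on tensor products of (real) test functions by
`wightmanFn_poincare_invariant`, hence everywhere by the density of their span
(`AQFT.denseSpan_tensorProducts_holds`). [cite: StreaterWightman1964, §3-3 eq. (3-21)] -/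
theorem _root_.Literature.MathematicalPhysics.QuantumLattice.IsWightmanQFT.wightmanDistribution_poincare_invariant_holds {W : WightmanData d κ} :
    IsWightmanQFT.wightmanDistribution_poincare_invariant (W := W) := by
  intro hW n k T hT g F
  have h : T.comp (poincareTestMulti n g) = T := by
    refine SchwingerFamily.ext_of_denseSpan denseSpan_tensorProducts_holds fun f G hG => ?_
    rw [ContinuousLinearMap.comp_apply, hT _ _ (hG.poincareTestMulti g), hT _ _ hG]
    exact hW.wightmanFn_poincare_invariant n k _ g
  have := congrArg (fun S : 𝓢((Fin n → SpaceTime d), ℂ) →L[ℂ] ℂ => S F) h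
  simpa using this

/-- Lorentz invariance of a Wightman distribution under a restricted Lorentz transformation `Λ`
(the pure Lorentz element `g = (0, Λ)`): `T (F ∘ Λ⁻¹) = T F`. [cite: StreaterWightman1964, §3-3 eq. (3-21)] -/
theorem _root_.Literature.MathematicalPhysics.QuantumLattice.IsWightmanDistributionOf.apply_poincareTestMulti_inr {W : WightmanData d κ}
    (hW : IsWightmanQFT W) {k : Fin n → κ} {T : 𝓢((Fin n → SpaceTime d), ℂ) →L[ℂ] ℂ}
    (hT : IsWightmanDistributionOf W n k T) (Λ : restrictedLorentzGroup d)
    (F : 𝓢((Fin n → SpaceTime d), ℂ)) :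
    T (poincareTestMulti n (SemidirectProduct.inr Λ) F) = T F :=
  IsWightmanQFT.wightmanDistribution_poincare_invariant_holds hW hT _ F

/-- Translation invariance of a Wightman distribution: `T(F(· − a, …, · − a)) = T(F)`. [cite: StreaterWightman1964, §3-3 eq. (3-21)] -/
theorem _root_.Literature.MathematicalPhysics.QuantumLattice.IsWightmanDistributionOf.apply_poincareTestMulti_inl {W : WightmanData d κ}
    (hW : IsWightmanQFT W) {k : Fin n → κ} {T : 𝓢((Fin n → SpaceTime d), ℂ) →L[ℂ] ℂ}
    (hT : IsWightmanDistributionOf W n k T) (a : SpaceTime d)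
    (F : 𝓢((Fin n → SpaceTime d), ℂ)) :
    T (poincareTestMulti n (SemidirectProduct.inl (Multiplicative.ofAdd a)) F) = T F :=
  IsWightmanQFT.wightmanDistribution_poincare_invariant_holds hW hT _ F

end Literature.MathematicalPhysics.QuantumFieldTheory
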